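import Literature.AlgebraicGeometry.GroupSchemes.UnitComponentReductionKernel
import HarnessLib

/-!
# Crux `HLiu418` — P6 sub-line **F0-P6b ConnectedEtale**, stub (b1b) `stub_b1b_kernelOfReduction` PAID

Cell `pub/hodgecm-mathlib`, P6 «MOD programme», HEART input (b1) (LEAD M-1a), organ sub-line `Cruxes/HLiu418/Lines/F0_P6b_ConnectedEtale.lean` ED. 1
(F0P6b-plan (g0), tree sha16 `8210ab19d71568b2`, commit 8dd49ff07d8f), registered-to-be stub `stub_b1b_kernelOfReduction` (§2, :79).  This file proves
THE TEXT of that stub with the line-local predicate `IsUnitComponent G G₀ j := IsMonHom j ∧ IsOpenImmersion j.left ∧ IsClosedImmersion j.left ∧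
ConnectedSpace G₀.left` (:52–:54 of the line) δ-UNFOLDED token for token (same binders, universe 0; nothing imports a `Cruxes/…/Lines` module), as
`stub_b1b_kernelOfReduction_holds`, so that the desk folds `stub_b1b_kernelOfReduction := …_holds` BY NAME at the next edition (the fold elaborates by
δ-reduction of `IsUnitComponent`).  The proof is the ★ Literature organ
`Literature.AlgebraicGeometry.GroupSchemes.UnitComponent.exists_factor_iff_reduction_eq_unit` (`GroupSchemes/UnitComponentReductionKernel.lean`):
(⇐) the open `t⁻¹(G₀) ⊆ Spec R′` contains the closed point, hence is everything; (⇒) `Γ(G₀, 𝒪)` is LOCAL (henselian base + connected + finite,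
[StacksProject] Tag 04GG), and a field-valued point of a local finite `R`-algebra with a section, lying over `res ∘ f` with `f` local, is unique
([Tate1997FiniteFlatGroupSchemes] (3.7); [SerreTate1968] §1 Lemma 1).  Seat F0P6-p11 (g0) (RE-DEAL 13:29:45Z).  HC_CM is proved only modulo the
printed citations until rung 0 closes; nothing here is about HC — it discharges one stub of an organ sub-line of the MOD programme.

## References
* [Tate1997FiniteFlatGroupSchemes] J. Tate, *Finite flat group schemes*, in: Modular Forms and Fermat's Last Theorem (1997), (3.7).
* [SerreTate1968] J.-P. Serre, J. Tate, *Good reduction of abelian varieties*, Ann. of Math. 88 (1968), §1 Lemma 1.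
* [StacksProject] The Stacks Project, Tags 04GG, 00EE, 01I1.
-/

set_option linter.dupNamespace false
set_option autoImplicit false

noncomputable section

namespace Summit.HodgeConjecture.HodgeConjecture.Cruxes.HLiu418.F0P6bConnectedEtaleStubB1b

open CategoryTheory AlgebraicGeometry MonoidalCategory IsLocalRing
open scoped MonObj

/-- **(b1b) PAID — the unit component is the kernel of the reduction map on local points** (the text of `stub_b1b_kernelOfReduction` of
`Lines/F0_P6b_ConnectedEtale.lean` ED. 1 with `IsUnitComponent` δ-unfolded; proof = ★
`Literature.AlgebraicGeometry.GroupSchemes.UnitComponent.exists_factor_iff_reduction_eq_unit`).  HENSELIAN `R` and LOCAL `R′`, `f` are load-bearing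
(the line card's A4 notes). [cite: Tate1997FiniteFlatGroupSchemes, (3.7)] [cite: SerreTate1968, §1 Lemma 1] -/
theorem stub_b1b_kernelOfReduction_holds :
    ∀ (R : Type) [CommRing R] [HenselianLocalRing R] (G G₀ : Over (Spec (.of R))) [GrpObj G] [GrpObj G₀] (j : G₀ ⟶ G),
      IsFinite G.hom → (IsMonHom j ∧ IsOpenImmersion j.left ∧ IsClosedImmersion j.left ∧ ConnectedSpace G₀.left) →
        ∀ (R' : Type) [CommRing R'] [IsLocalRing R'] (f : R →+* R') [IsLocalHom f] (t : Spec (.of R') ⟶ G.left),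
          t ≫ G.hom = Spec.map (CommRingCat.ofHom f) →
            ((∃ s : Spec (.of R') ⟶ G₀.left, s ≫ j.left = t) ↔
              Spec.map (CommRingCat.ofHom (residue R')) ≫ t =
                Spec.map (CommRingCat.ofHom ((residue R').comp f)) ≫ η[G].left) := by
  intro R _ _ G G₀ _ _ j hG hj R' _ _ f _ t ht
  obtain ⟨h1, h2, h3, h4⟩ := hj
  haveI := hG; haveI := h1; haveI := h2; haveI := h3; haveI := h4
  exact Literature.AlgebraicGeometry.GroupSchemes.UnitComponent.exists_factor_iff_reduction_eq_unit R G G₀ j R' f t ht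

end Summit.HodgeConjecture.HodgeConjecture.Cruxes.HLiu418.F0P6bConnectedEtaleStubB1b

end
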